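import Summits.QuantumFields.YangMills.Theorems.UnitScaleTiltProp7OffsetFamilyTransported
import Summits.QuantumFields.YangMills.Theorems.UnitScaleTiltProp7LemmaHCurvedDirichletCountExact
import HarnessLib

/-!
# Route `UnitScaleTilt`, crux K1 «MinimiserStabilityRegPr» (stmt-QuantumFields-19200), route-R E′ path (α′), S3 K-form engine, row (H) ∕ (R4′) — FILE 9n″ (T³ letters):
# THE (α) LETTER WITH EXACT MULTIPLICITIES — the `_exact` re-cut of ✓p675776 §2 `lemmaH_curved_comb_avg_count` (generic averaged axial family) and of ✓p676852
# `lemmaH_curved_offset_avg_count_transported` (the offset-comb family, window rows discharged, transported-plaquette letters `‖[P̃, φ₀(c_y)]‖²`): the Dirichlet family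
# `Σ_y |H|⁻¹Σ_η 2·Σ_μ (|t_μ|R)·Σ_i (2R+1)^(|t_μ|−i)·Σ_q (f⁺ + f⁻)` of the sup-count becomes `Σ_y |H|⁻¹Σ_η 2·Σ_μ Σ_i Σ_q (W⁺_(μ,i)(q)·f⁺ + W⁻_(μ,i)(q)·f⁻)` with the EXACT
# trunk-supported weights of ✓ `Prop7CombLadderCountExact` (✓p678641; closed forms ✓p678898) — every other letter, row and constant VERBATIM

Cell `ym3-torus`, width seat `ym3-torus-px9` (gen 4); ★ym-ust-19200-p1 g16 NAMER WORD 4 (1) (2026-08-28 23:31Z) «px9: F-H9h″ EXACT-MULT GO … then the `_exact` re-cut of ✓p676852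
(routeR-w1's letters; routeR-w1 holds the `_pt` chain, you hold the count)»; routeR-w1 g6 23:33Z «your `_exact` re-cut replaces `sum_box_comm_loop_sq_le`'s RHS only».  THEOREMS ONLY
(0 `def`, 0 `sorry`); `--supports stmt-QuantumFields-19200 --as helper`, count-neutral.  YM₃ on T³ is a RUNG of the ladder (R3) — not d = 4, not infinite volume, not a mass gap, not
the Clay problem; nothing here claims a stub, the crux or any summit statement.

WHAT IS PROVED (ns `…Theorems.Prop7OffsetFamilyTransportedExact`; statements = the originals with ONLY the Dirichlet family block replaced).
* ★★★ `lemmaH_curved_comb_avg_count_exact` — ✓ `lemmaH_curved_comb_avg_count` (any finite family `H`, bases `c`, data `mdat`, rows `hinterp hwrap hG hbox`, splits) with exact weights;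
  proof = door ✓ `lemmaH_curved_comb_avg` ∘ ✓ `sum_ite_comm_loopT_sq_le_canonical_exact` per `(y, η)`.
* ★★★ `lemmaH_curved_offset_avg_count_transported_exact` — ✓p676852's (α) letter with exact weights: offset bases `c^h_y = c_y + h·e_ι` (`h < ℓ′`), `R = 2ℓ + ℓ′`, window rows
  discharged by ✓ `abs_rel_offset_le`, interpolation by ✓ `offsetFamily_interp`, letters transported by ✓ `canonical_letter_eq_transported`; remaining displayed rows `hψ`, `hG`, splits.
HONEST SCOPE.  Re-cut only (bookkeeping); the weights are explicit filtered box sums whose support ∕ closed form ∕ mass are ✓ `Prop7CombLadderCountExactWeights`; no booking against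
`K_gauge` (R5's rows hKg′-K ∕ hDir, the namer's pen); routeR-w1's `_pt` chain (pointwise `G` group) is orthogonal to this edit and merges by the same two proofs.

References: T. Bałaban, CMP 98 (1985) 17–51 [Balaban1985Averaging] ((9) pp.18–19, (19)–(20) p.21, p.24); CMP 102 (1985) 255–275 [Balaban1985UV3] ((27) p.263); CMP 99 (1985)
389–434 [Balaban1985BackgroundPropagators] ((3.1), (3.3) p.390, (3.8) p.392).
-/

set_option autoImplicit false

noncomputable section

open scoped BigOperators Matrix.Norms.L2Operator Matrix

namespace Summit.QuantumFields.YangMills.Theorems.Prop7OffsetFamilyTransportedExact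

open Literature.MathematicalPhysics.QuantumFieldTheory.Balaban1983to89
open Literature.MathematicalPhysics.QuantumFieldTheory.Balaban1983to89.T3ContinuumYM3Torus
open B7Prop1Explicit (Letter e seg treeWord hol)
open B9Eq39Adjoint (R covD covDstar divB)
open B9TorusCalculus (torusT)
open B10Eq27TorusAxialLog (unitsField toUField holT axialT contourT rel pull transl)
open B5Eq118OneStroke (iterBlockOf)
open B15DeterminingSets (embIter)
open Summit.QuantumFields.YangMills.Theorems.Prop7CovHodgeSplit (unitsField_toUField_mem_unitary)
open Summit.QuantumFields.YangMills.Theorems.Prop7LemmaHCurvedOfRows (bicontr_of_mem_unitary)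
open Summit.QuantumFields.YangMills.Theorems.Prop7LocalModelAverage (lemmaH_curved_comb_avg)
open Summit.QuantumFields.YangMills.Theorems.Prop7LemmaHCurvedDirichletCount (sum_ite_sum_mul_sum_comm)
open Summit.QuantumFields.YangMills.Theorems.Prop7LemmaHCurvedDirichletCountExact (sum_ite_comm_loopT_sq_le_canonical_exact)
open Summit.QuantumFields.YangMills.Theorems.Prop7AxialOffsetFamily (offsetFamily_interp)
open Summit.QuantumFields.YangMills.Theorems.Prop7OffsetFamilyWindow (abs_rel_offset_le)
open Summit.QuantumFields.YangMills.Theorems.Prop7OffsetFamilyTransported (canonical_letter_eq_transported)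

/-! ## §1 The generic averaged family, exact -/

section Generic

variable {H : Type*} [Fintype H] [Nonempty H]

/-- ★★★ **LEMMA-H-CURVED AT AN AVERAGED AXIAL FAMILY, DIRICHLET GROUP COUNTED EXACTLY** — ✓ `lemmaH_curved_comb_avg_count` (✓p675776 §2) with its Dirichlet family
`Σ_y |H|⁻¹Σ_η 2·Σ_μ (|t_μ|R)·Σ_(i<|t_μ|) (2R+1)^(|t_μ|−i)·Σ_q (f⁺+f⁻)` replaced by `Σ_y |H|⁻¹Σ_η 2·Σ_μ Σ_(i<|t_μ|) Σ_(q∈[−R,R]^d) (W⁺_(μ,i)(q)·f_(η,y)(q,(t_(μ,i),+)) + W⁻_(μ,i)(q)·f_(η,y)(q,(t_(μ,i),−)))`,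
`f_(η,y)(q,l) = ‖[𝒲^(c^η_y)_q(l μ l̄ μ̄), R(𝒲^(c^η_y)(Γ_(0,q))⁻¹) m^η_y]‖²`, `W^±_(μ,i)(q) = Σ_(v ∈ box, P^±(v,q)) |B_μ(v)|` EXACT (trunk-supported filtered box sums, ✓ `Prop7CombLadderCountExact`);
Laplacian group and `G` group verbatim; rows `hinterp hwrap hG hbox`, splits displayed. [cite: Balaban1985Averaging, (9) p.18, (19)–(20) p.21, p.24] [cite: Balaban1985UV3, (27) p.263]
[cite: Balaban1985BackgroundPropagators, (3.3) p.390, (3.8) p.392] -/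
theorem lemmaH_curved_comb_avg_count_exact (F : T3Family) (K n : ℕ) (hk : K - n ≤ (F.P K).m + (F.P K).K) (hℓ2 : 2 ≤ (F.P K).L ^ (K - n))
    (W : GaugeField (F.P K) 0 (Matrix.specialUnitaryGroup (Fin 2) ℂ)) (ψ : Site (F.P K) 0 → Matrix (Fin 2) (Fin 2) ℂ)
    (hψ : ∀ x : Site (F.P K) 0, x ∉ Set.range (embIter (K - n)) →
      divB (torusT (F.P K) 0) (fun κ z => unitsField (toUField W) ⟨z, κ⟩) (fun κ y => covD (torusT (F.P K) 0) (fun κ z => unitsField (toUField W) ⟨z, κ⟩) κ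
        (fun z => divB (torusT (F.P K) 0) (fun κ z => unitsField (toUField W) ⟨z, κ⟩)
          (fun ν w => covD (torusT (F.P K) 0) (fun κ z => unitsField (toUField W) ⟨z, κ⟩) ν ψ w) z) y) x = 0)
    (c : H → Site (F.P K) (K - n) → Site (F.P K) 0) (mdat : H → Site (F.P K) (K - n) → Matrix (Fin 2) (Fin 2) ℂ)
    (hinterp : ∀ η y, R (axialT (unitsField (toUField W)) (c η y) (embIter (K - n) y))⁻¹ (mdat η y) = ψ (embIter (K - n) y))
    (hwrap : ∀ (η : H) (y : Site (F.P K) (K - n)) (z : Site (F.P K) 0),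
      (∀ ν : Fin (F.P K).d,
        (y ν = (iterBlockOf (K - n) (fun κ => z κ - (((((F.P K).L ^ (K - n) - 1) / 2 : ℕ)) : ZMod ((F.P K).sitesPerDir 0)))) ν - 1
        ∨ y ν = (iterBlockOf (K - n) (fun κ => z κ - (((((F.P K).L ^ (K - n) - 1) / 2 : ℕ)) : ZMod ((F.P K).sitesPerDir 0)))) ν
        ∨ y ν = (iterBlockOf (K - n) (fun κ => z κ - (((((F.P K).L ^ (K - n) - 1) / 2 : ℕ)) : ZMod ((F.P K).sitesPerDir 0)))) ν + 1
        ∨ y ν = (iterBlockOf (K - n) (fun κ => z κ - (((((F.P K).L ^ (K - n) - 1) / 2 : ℕ)) : ZMod ((F.P K).sitesPerDir 0)))) ν + 2)) →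
      ∀ μ : Fin (F.P K).d, (rel (c η y) z μ + 1) * 2 ≤ ((F.P K).sitesPerDir 0 : ℤ)
        ∧ (rel (c η y) ((torusT (F.P K) 0 μ).symm z) μ + 1) * 2 ≤ ((F.P K).sitesPerDir 0 : ℤ))
    (Z : Fin (F.P K).d → Site (F.P K) 0 → Matrix (Fin 2) (Fin 2) ℂ) (G : Site (F.P K) (K - n) → ℝ)
    (hG : ∀ (y : Site (F.P K) (K - n)) (z : Site (F.P K) 0),
      (∀ ν : Fin (F.P K).d,
        (y ν = (iterBlockOf (K - n) (fun κ => z κ - (((((F.P K).L ^ (K - n) - 1) / 2 : ℕ)) : ZMod ((F.P K).sitesPerDir 0)))) ν - 1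
        ∨ y ν = (iterBlockOf (K - n) (fun κ => z κ - (((((F.P K).L ^ (K - n) - 1) / 2 : ℕ)) : ZMod ((F.P K).sitesPerDir 0)))) ν
        ∨ y ν = (iterBlockOf (K - n) (fun κ => z κ - (((((F.P K).L ^ (K - n) - 1) / 2 : ℕ)) : ZMod ((F.P K).sitesPerDir 0)))) ν + 1
        ∨ y ν = (iterBlockOf (K - n) (fun κ => z κ - (((((F.P K).L ^ (K - n) - 1) / 2 : ℕ)) : ZMod ((F.P K).sitesPerDir 0)))) ν + 2)) →
      ∀ μ : Fin (F.P K).d, ‖(Fintype.card H : ℝ)⁻¹ • ∑ η, R (axialT (unitsField (toUField W)) (c η y) z)⁻¹ (mdat η y) - Z μ z‖ ≤ G y)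
    (R₀ : ℕ) (hbox : ∀ (η : H) (y : Site (F.P K) (K - n)) (z : Site (F.P K) 0),
      (∀ ν : Fin (F.P K).d,
        (y ν = (iterBlockOf (K - n) (fun κ => z κ - (((((F.P K).L ^ (K - n) - 1) / 2 : ℕ)) : ZMod ((F.P K).sitesPerDir 0)))) ν - 1
        ∨ y ν = (iterBlockOf (K - n) (fun κ => z κ - (((((F.P K).L ^ (K - n) - 1) / 2 : ℕ)) : ZMod ((F.P K).sitesPerDir 0)))) ν
        ∨ y ν = (iterBlockOf (K - n) (fun κ => z κ - (((((F.P K).L ^ (K - n) - 1) / 2 : ℕ)) : ZMod ((F.P K).sitesPerDir 0)))) ν + 1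
        ∨ y ν = (iterBlockOf (K - n) (fun κ => z κ - (((((F.P K).L ^ (K - n) - 1) / 2 : ℕ)) : ZMod ((F.P K).sitesPerDir 0)))) ν + 2)) →
      ∀ (μ : Fin (F.P K).d) (ν : Fin (F.P K).d), |rel (c η y) z ν| ≤ (R₀ : ℤ) ∧ |rel (c η y) ((torusT (F.P K) 0 μ).symm z) ν| ≤ (R₀ : ℤ))
    (s t : Fin (F.P K).d → List (Fin (F.P K).d)) (hsplit : ∀ μ, (List.finRange (F.P K).d).reverse = s μ ++ μ :: t μ) (hs : ∀ μ, μ ∉ s μ) (ht : ∀ μ, μ ∉ t μ) :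
    (F.L : ℝ) ^ (K - n) * ∑ x : Site (F.P K) 0, ∑ a : Fin 2, ∑ b : Fin 2,
        Complex.normSq ((divB (torusT (F.P K) 0) (fun κ z => unitsField (toUField W) ⟨z, κ⟩)
          (fun κ y => covD (torusT (F.P K) 0) (fun κ z => unitsField (toUField W) ⟨z, κ⟩) κ ψ y) x) a b)
      ≤ (F.L : ℝ) ^ (K - n) * (2 * (
          3 * ∑ y : Site (F.P K) (K - n), ∑ z : Site (F.P K) 0,
            (if (∀ ν : Fin (F.P K).d,
                (y ν = (iterBlockOf (K - n) (fun κ => z κ - (((((F.P K).L ^ (K - n) - 1) / 2 : ℕ)) : ZMod ((F.P K).sitesPerDir 0)))) ν - 1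
                ∨ y ν = (iterBlockOf (K - n) (fun κ => z κ - (((((F.P K).L ^ (K - n) - 1) / 2 : ℕ)) : ZMod ((F.P K).sitesPerDir 0)))) ν
                ∨ y ν = (iterBlockOf (K - n) (fun κ => z κ - (((((F.P K).L ^ (K - n) - 1) / 2 : ℕ)) : ZMod ((F.P K).sitesPerDir 0)))) ν + 1
                ∨ y ν = (iterBlockOf (K - n) (fun κ => z κ - (((((F.P K).L ^ (K - n) - 1) / 2 : ℕ)) : ZMod ((F.P K).sitesPerDir 0)))) ν + 2))
              then (Fintype.card H : ℝ)⁻¹ * ∑ η, (∑ μ : Fin (F.P K).d,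
                      (‖(((holT (unitsField (toUField W)) (c η y) (contourT (c η y) ⟨(torusT (F.P K) 0 μ).symm z, μ⟩))⁻¹
                            * holT (unitsField (toUField W)) (c η y) (contourT (c η y) ⟨z, μ⟩) : (Matrix (Fin 2) (Fin 2) ℂ)ˣ) : Matrix (Fin 2) (Fin 2) ℂ) * mdat η y
                        - mdat η y * (((holT (unitsField (toUField W)) (c η y) (contourT (c η y) ⟨(torusT (F.P K) 0 μ).symm z, μ⟩))⁻¹
                            * holT (unitsField (toUField W)) (c η y) (contourT (c η y) ⟨z, μ⟩) : (Matrix (Fin 2) (Fin 2) ℂ)ˣ) : Matrix (Fin 2) (Fin 2) ℂ)‖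
                        + 2 * ‖((holT (unitsField (toUField W)) (c η y) (contourT (c η y) ⟨(torusT (F.P K) 0 μ).symm z, μ⟩) :
                                (Matrix (Fin 2) (Fin 2) ℂ)ˣ) : Matrix (Fin 2) (Fin 2) ℂ) - 1‖
                          * ‖((holT (unitsField (toUField W)) (c η y) (contourT (c η y) ⟨(torusT (F.P K) 0 μ).symm z, μ⟩) :
                                (Matrix (Fin 2) (Fin 2) ℂ)ˣ) : Matrix (Fin 2) (Fin 2) ℂ) * mdat η y
                              - mdat η y * ((holT (unitsField (toUField W)) (c η y) (contourT (c η y) ⟨(torusT (F.P K) 0 μ).symm z, μ⟩) :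
                                (Matrix (Fin 2) (Fin 2) ℂ)ˣ) : Matrix (Fin 2) (Fin 2) ℂ)‖)) ^ 2
              else 0)
          + 3 * (2 * ((F.P K).d : ℝ) * (6 / ((((F.P K).L ^ (K - n) : ℕ) : ℝ)))) * (3 / ((((F.P K).L ^ (K - n) : ℕ) : ℝ)))
            * ∑ y : Site (F.P K) (K - n), (Fintype.card H : ℝ)⁻¹ * ∑ η, (2 * ∑ μ : Fin (F.P K).d,
              ∑ i ∈ Finset.range (t μ).length, ∑ q ∈ Fintype.piFinset (fun _ : Fin (F.P K).d => Finset.Icc (-(R₀ : ℤ)) (R₀ : ℤ)),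
                ((∑ v ∈ (Fintype.piFinset (fun _ : Fin (F.P K).d => Finset.Icc (-(R₀ : ℤ)) (R₀ : ℤ))).filter
                    (fun v => (∀ ν ∈ ((t μ).take i).foldl (fun S ν => insert ν S) (insert μ (s μ).toFinset), q ν = v ν)
                      ∧ (∀ ν, ν ∉ ((t μ).take i).foldl (fun S ν => insert ν S) (insert μ (s μ).toFinset) → ν ≠ (t μ).getD i μ → q ν = 0)
                      ∧ 0 ≤ q ((t μ).getD i μ) ∧ q ((t μ).getD i μ) < v ((t μ).getD i μ)), ((((t μ).flatMap (fun κ => seg κ (v κ))).length : ℕ) : ℝ))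
                  * ‖((hol (pull (unitsField (toUField W)) (c η y)) q [((t μ).getD i μ, true), (μ, true), Letter.rev ((t μ).getD i μ, true), (μ, false)] : (Matrix (Fin 2) (Fin 2) ℂ)ˣ) : Matrix (Fin 2) (Fin 2) ℂ)
                        * R (hol (pull (unitsField (toUField W)) (c η y)) 0 (treeWord q))⁻¹ (mdat η y)
                      - R (hol (pull (unitsField (toUField W)) (c η y)) 0 (treeWord q))⁻¹ (mdat η y)
                        * ((hol (pull (unitsField (toUField W)) (c η y)) q [((t μ).getD i μ, true), (μ, true), Letter.rev ((t μ).getD i μ, true), (μ, false)] : (Matrix (Fin 2) (Fin 2) ℂ)ˣ) : Matrix (Fin 2) (Fin 2) ℂ)‖ ^ 2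
                + (∑ v ∈ (Fintype.piFinset (fun _ : Fin (F.P K).d => Finset.Icc (-(R₀ : ℤ)) (R₀ : ℤ))).filter
                    (fun v => (∀ ν ∈ ((t μ).take i).foldl (fun S ν => insert ν S) (insert μ (s μ).toFinset), q ν = v ν)
                      ∧ (∀ ν, ν ∉ ((t μ).take i).foldl (fun S ν => insert ν S) (insert μ (s μ).toFinset) → ν ≠ (t μ).getD i μ → q ν = 0)
                      ∧ v ((t μ).getD i μ) < q ((t μ).getD i μ) ∧ q ((t μ).getD i μ) ≤ 0), ((((t μ).flatMap (fun κ => seg κ (v κ))).length : ℕ) : ℝ))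
                  * ‖((hol (pull (unitsField (toUField W)) (c η y)) q [((t μ).getD i μ, false), (μ, true), Letter.rev ((t μ).getD i μ, false), (μ, false)] : (Matrix (Fin 2) (Fin 2) ℂ)ˣ) : Matrix (Fin 2) (Fin 2) ℂ)
                        * R (hol (pull (unitsField (toUField W)) (c η y)) 0 (treeWord q))⁻¹ (mdat η y)
                      - R (hol (pull (unitsField (toUField W)) (c η y)) 0 (treeWord q))⁻¹ (mdat η y)
                        * ((hol (pull (unitsField (toUField W)) (c η y)) q [((t μ).getD i μ, false), (μ, true), Letter.rev ((t μ).getD i μ, false), (μ, false)] : (Matrix (Fin 2) (Fin 2) ℂ)ˣ) : Matrix (Fin 2) (Fin 2) ℂ)‖ ^ 2))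
          + 3 * ((F.P K).d : ℝ) ^ 2 * (24 / ((((F.P K).L ^ (K - n) : ℕ) : ℝ)) ^ 2)
            * (24 / ((((F.P K).L ^ (K - n) : ℕ) : ℝ)) ^ 2 * ((((F.P K).L ^ (K - n) : ℕ) : ℝ)) ^ (F.P K).d) * ∑ y : Site (F.P K) (K - n), G y ^ 2)) := by
  have hc : (0 : ℝ) ≤ (Fintype.card H : ℝ)⁻¹ := by positivity
  have hV : ∀ b : PBond (F.P K) 0, ‖((unitsField (toUField W) b : (Matrix (Fin 2) (Fin 2) ℂ)ˣ) : Matrix (Fin 2) (Fin 2) ℂ)‖ ≤ 1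
      ∧ ‖(((unitsField (toUField W) b)⁻¹ : (Matrix (Fin 2) (Fin 2) ℂ)ˣ) : Matrix (Fin 2) (Fin 2) ℂ)‖ ≤ 1 :=
    fun b => bicontr_of_mem_unitary _ (unitsField_toUField_mem_unitary W b.dir b.src)
  have main := lemmaH_curved_comb_avg F K n hk hℓ2 W ψ hψ c mdat hinterp hwrap Z G hG
  refine main.trans (mul_le_mul_of_nonneg_left (mul_le_mul_of_nonneg_left (add_le_add (add_le_add le_rfl ?_) le_rfl) (by norm_num)) (by positivity))
  refine mul_le_mul_of_nonneg_left (Finset.sum_le_sum fun y _ => ?_) (by positivity)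
  rw [sum_ite_sum_mul_sum_comm]
  refine mul_le_mul_of_nonneg_left (Finset.sum_le_sum fun η _ => ?_) hc
  exact sum_ite_comm_loopT_sq_le_canonical_exact (unitsField (toUField W)) hV (c η y) (mdat η y) _ R₀ (fun z hz μ ν => hbox η y z hz μ ν) s t hsplit hs ht

end Generic

/-! ## §2 The offset-comb family, windowed and transported, exact -/

section T3

/-- ★★★ **THE (α) LETTER IN TRANSPORTED-PLAQUETTE LETTERS WITH EXACT MULTIPLICITIES** — ✓p676852 `lemmaH_curved_offset_avg_count_transported` with its Dirichlet family replaced by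
`Σ_y ℓ′⁻¹Σ_(h<ℓ′) 2·Σ_μ Σ_(i<|t_μ|) Σ_(q∈[−R,R]^d) (W⁺_(μ,i)(q)·‖[P̃⁺, φ₀(c_y)]‖² + W⁻_(μ,i)(q)·‖[P̃⁻, φ₀(c_y)]‖²)`, `P̃^± = R(𝒲(c_y; [ι]^h ++ Γ_(0,q)))·𝒲_(c^h_y+q)((t_(μ,i),±) μ (t_(μ,i),±)⁻ μ⁻)`,
`R = 2ℓ + ℓ′`, `W^±_(μ,i)(q) = Σ_(v ∈ box, P^±(v,q)) |B_μ(v)|` the EXACT trunk-supported weights (✓ `Prop7CombLadderCountExact`; closed form `(R ∓ q κ)·(2R+1)^(d−(|D|+1))` on the trunk,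
✓ `Prop7CombLadderCountExactWeights`); Laplacian group and `G` group verbatim; remaining displayed rows `hψ`, `hG`, splits.
[cite: Balaban1985Averaging, (9) p.18, (19)–(20) p.21, p.24] [cite: Balaban1985UV3, (27) p.263] [cite: Balaban1985BackgroundPropagators, (3.1) p.390] -/
theorem lemmaH_curved_offset_avg_count_transported_exact (F : T3Family) (K n : ℕ) (hk : K - n ≤ (F.P K).m + (F.P K).K) (hℓ2 : 2 ≤ (F.P K).L ^ (K - n))
    (W : GaugeField (F.P K) 0 (Matrix.specialUnitaryGroup (Fin 2) ℂ)) (ψ : Site (F.P K) 0 → Matrix (Fin 2) (Fin 2) ℂ)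
    (hψ : ∀ x : Site (F.P K) 0, x ∉ Set.range (embIter (K - n)) →
      divB (torusT (F.P K) 0) (fun κ z => unitsField (toUField W) ⟨z, κ⟩) (fun κ y => covD (torusT (F.P K) 0) (fun κ z => unitsField (toUField W) ⟨z, κ⟩) κ
        (fun z => divB (torusT (F.P K) 0) (fun κ z => unitsField (toUField W) ⟨z, κ⟩)
          (fun ν w => covD (torusT (F.P K) 0) (fun κ z => unitsField (toUField W) ⟨z, κ⟩) ν ψ w) z) y) x = 0)
    (ι : Fin (F.P K).d) (ℓ' : ℕ) [NeZero ℓ'] (hN : (2 * (F.P K).L ^ (K - n) + ℓ') * 2 < (F.P K).sitesPerDir 0)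
    (Z : Fin (F.P K).d → Site (F.P K) 0 → Matrix (Fin 2) (Fin 2) ℂ) (G : Site (F.P K) (K - n) → ℝ)
    (hG : ∀ (y : Site (F.P K) (K - n)) (z : Site (F.P K) 0),
      (∀ ν : Fin (F.P K).d,
        (y ν = (iterBlockOf (K - n) (fun κ => z κ - (((((F.P K).L ^ (K - n) - 1) / 2 : ℕ)) : ZMod ((F.P K).sitesPerDir 0)))) ν - 1
        ∨ y ν = (iterBlockOf (K - n) (fun κ => z κ - (((((F.P K).L ^ (K - n) - 1) / 2 : ℕ)) : ZMod ((F.P K).sitesPerDir 0)))) ν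
        ∨ y ν = (iterBlockOf (K - n) (fun κ => z κ - (((((F.P K).L ^ (K - n) - 1) / 2 : ℕ)) : ZMod ((F.P K).sitesPerDir 0)))) ν + 1
        ∨ y ν = (iterBlockOf (K - n) (fun κ => z κ - (((((F.P K).L ^ (K - n) - 1) / 2 : ℕ)) : ZMod ((F.P K).sitesPerDir 0)))) ν + 2)) →
      ∀ μ : Fin (F.P K).d, ‖(ℓ' : ℝ)⁻¹ • ∑ η : Fin ℓ', R (axialT (unitsField (toUField W)) (transl (embIter (K - n) y) (((η : ℕ) : ℤ) • e ι)) z)⁻¹ (R (holT (unitsField (toUField W)) (embIter (K - n) y) (seg ι ((η : ℕ) : ℤ)))⁻¹ (ψ (embIter (K - n) y))) - Z μ z‖ ≤ G y)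
    (s t : Fin (F.P K).d → List (Fin (F.P K).d)) (hsplit : ∀ μ, (List.finRange (F.P K).d).reverse = s μ ++ μ :: t μ) (hs : ∀ μ, μ ∉ s μ) (ht : ∀ μ, μ ∉ t μ) :
    (F.L : ℝ) ^ (K - n) * ∑ x : Site (F.P K) 0, ∑ a : Fin 2, ∑ b : Fin 2,
        Complex.normSq ((divB (torusT (F.P K) 0) (fun κ z => unitsField (toUField W) ⟨z, κ⟩)
          (fun κ y => covD (torusT (F.P K) 0) (fun κ z => unitsField (toUField W) ⟨z, κ⟩) κ ψ y) x) a b)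
      ≤ (F.L : ℝ) ^ (K - n) * (2 * (
          3 * ∑ y : Site (F.P K) (K - n), ∑ z : Site (F.P K) 0,
            (if (∀ ν : Fin (F.P K).d,
                (y ν = (iterBlockOf (K - n) (fun κ => z κ - (((((F.P K).L ^ (K - n) - 1) / 2 : ℕ)) : ZMod ((F.P K).sitesPerDir 0)))) ν - 1
                ∨ y ν = (iterBlockOf (K - n) (fun κ => z κ - (((((F.P K).L ^ (K - n) - 1) / 2 : ℕ)) : ZMod ((F.P K).sitesPerDir 0)))) ν
                ∨ y ν = (iterBlockOf (K - n) (fun κ => z κ - (((((F.P K).L ^ (K - n) - 1) / 2 : ℕ)) : ZMod ((F.P K).sitesPerDir 0)))) ν + 1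
                ∨ y ν = (iterBlockOf (K - n) (fun κ => z κ - (((((F.P K).L ^ (K - n) - 1) / 2 : ℕ)) : ZMod ((F.P K).sitesPerDir 0)))) ν + 2))
              then (ℓ' : ℝ)⁻¹ * ∑ η : Fin ℓ', (∑ μ : Fin (F.P K).d,
                      (‖(((holT (unitsField (toUField W)) (transl (embIter (K - n) y) (((η : ℕ) : ℤ) • e ι)) (contourT (transl (embIter (K - n) y) (((η : ℕ) : ℤ) • e ι)) ⟨(torusT (F.P K) 0 μ).symm z, μ⟩))⁻¹
                            * holT (unitsField (toUField W)) (transl (embIter (K - n) y) (((η : ℕ) : ℤ) • e ι)) (contourT (transl (embIter (K - n) y) (((η : ℕ) : ℤ) • e ι)) ⟨z, μ⟩) : (Matrix (Fin 2) (Fin 2) ℂ)ˣ) : Matrix (Fin 2) (Fin 2) ℂ) * R (holT (unitsField (toUField W)) (embIter (K - n) y) (seg ι ((η : ℕ) : ℤ)))⁻¹ (ψ (embIter (K - n) y))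
                        - R (holT (unitsField (toUField W)) (embIter (K - n) y) (seg ι ((η : ℕ) : ℤ)))⁻¹ (ψ (embIter (K - n) y)) * (((holT (unitsField (toUField W)) (transl (embIter (K - n) y) (((η : ℕ) : ℤ) • e ι)) (contourT (transl (embIter (K - n) y) (((η : ℕ) : ℤ) • e ι)) ⟨(torusT (F.P K) 0 μ).symm z, μ⟩))⁻¹
                            * holT (unitsField (toUField W)) (transl (embIter (K - n) y) (((η : ℕ) : ℤ) • e ι)) (contourT (transl (embIter (K - n) y) (((η : ℕ) : ℤ) • e ι)) ⟨z, μ⟩) : (Matrix (Fin 2) (Fin 2) ℂ)ˣ) : Matrix (Fin 2) (Fin 2) ℂ)‖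
                        + 2 * ‖((holT (unitsField (toUField W)) (transl (embIter (K - n) y) (((η : ℕ) : ℤ) • e ι)) (contourT (transl (embIter (K - n) y) (((η : ℕ) : ℤ) • e ι)) ⟨(torusT (F.P K) 0 μ).symm z, μ⟩) :
                                (Matrix (Fin 2) (Fin 2) ℂ)ˣ) : Matrix (Fin 2) (Fin 2) ℂ) - 1‖
                          * ‖((holT (unitsField (toUField W)) (transl (embIter (K - n) y) (((η : ℕ) : ℤ) • e ι)) (contourT (transl (embIter (K - n) y) (((η : ℕ) : ℤ) • e ι)) ⟨(torusT (F.P K) 0 μ).symm z, μ⟩) :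
                                (Matrix (Fin 2) (Fin 2) ℂ)ˣ) : Matrix (Fin 2) (Fin 2) ℂ) * R (holT (unitsField (toUField W)) (embIter (K - n) y) (seg ι ((η : ℕ) : ℤ)))⁻¹ (ψ (embIter (K - n) y))
                              - R (holT (unitsField (toUField W)) (embIter (K - n) y) (seg ι ((η : ℕ) : ℤ)))⁻¹ (ψ (embIter (K - n) y)) * ((holT (unitsField (toUField W)) (transl (embIter (K - n) y) (((η : ℕ) : ℤ) • e ι)) (contourT (transl (embIter (K - n) y) (((η : ℕ) : ℤ) • e ι)) ⟨(torusT (F.P K) 0 μ).symm z, μ⟩) :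
                                (Matrix (Fin 2) (Fin 2) ℂ)ˣ) : Matrix (Fin 2) (Fin 2) ℂ)‖)) ^ 2
              else 0)
          + 3 * (2 * ((F.P K).d : ℝ) * (6 / ((((F.P K).L ^ (K - n) : ℕ) : ℝ)))) * (3 / ((((F.P K).L ^ (K - n) : ℕ) : ℝ)))
            * ∑ y : Site (F.P K) (K - n), (ℓ' : ℝ)⁻¹ * ∑ η : Fin ℓ', (2 * ∑ μ : Fin (F.P K).d,
              ∑ i ∈ Finset.range (t μ).length, ∑ q ∈ Fintype.piFinset (fun _ : Fin (F.P K).d => Finset.Icc (-((2 * (F.P K).L ^ (K - n) + ℓ') : ℤ)) ((2 * (F.P K).L ^ (K - n) + ℓ') : ℤ)),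
                ((∑ v ∈ (Fintype.piFinset (fun _ : Fin (F.P K).d => Finset.Icc (-((2 * (F.P K).L ^ (K - n) + ℓ') : ℤ)) ((2 * (F.P K).L ^ (K - n) + ℓ') : ℤ))).filter
                    (fun v => (∀ ν ∈ ((t μ).take i).foldl (fun S ν => insert ν S) (insert μ (s μ).toFinset), q ν = v ν)
                      ∧ (∀ ν, ν ∉ ((t μ).take i).foldl (fun S ν => insert ν S) (insert μ (s μ).toFinset) → ν ≠ (t μ).getD i μ → q ν = 0)
                      ∧ 0 ≤ q ((t μ).getD i μ) ∧ q ((t μ).getD i μ) < v ((t μ).getD i μ)), ((((t μ).flatMap (fun κ => seg κ (v κ))).length : ℕ) : ℝ))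
                  * ‖R (holT (unitsField (toUField W)) (embIter (K - n) y) (seg ι ((η : ℕ) : ℤ) ++ treeWord q))
                          ((holT (unitsField (toUField W)) (transl (transl (embIter (K - n) y) (((η : ℕ) : ℤ) • e ι)) q) [((t μ).getD i μ, true), (μ, true), Letter.rev ((t μ).getD i μ, true), (μ, false)] : (Matrix (Fin 2) (Fin 2) ℂ)ˣ) : Matrix (Fin 2) (Fin 2) ℂ)
                        * ψ (embIter (K - n) y)
                      - ψ (embIter (K - n) y)
                        * R (holT (unitsField (toUField W)) (embIter (K - n) y) (seg ι ((η : ℕ) : ℤ) ++ treeWord q))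
                          ((holT (unitsField (toUField W)) (transl (transl (embIter (K - n) y) (((η : ℕ) : ℤ) • e ι)) q) [((t μ).getD i μ, true), (μ, true), Letter.rev ((t μ).getD i μ, true), (μ, false)] : (Matrix (Fin 2) (Fin 2) ℂ)ˣ) : Matrix (Fin 2) (Fin 2) ℂ)‖ ^ 2
                + (∑ v ∈ (Fintype.piFinset (fun _ : Fin (F.P K).d => Finset.Icc (-((2 * (F.P K).L ^ (K - n) + ℓ') : ℤ)) ((2 * (F.P K).L ^ (K - n) + ℓ') : ℤ))).filter
                    (fun v => (∀ ν ∈ ((t μ).take i).foldl (fun S ν => insert ν S) (insert μ (s μ).toFinset), q ν = v ν)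
                      ∧ (∀ ν, ν ∉ ((t μ).take i).foldl (fun S ν => insert ν S) (insert μ (s μ).toFinset) → ν ≠ (t μ).getD i μ → q ν = 0)
                      ∧ v ((t μ).getD i μ) < q ((t μ).getD i μ) ∧ q ((t μ).getD i μ) ≤ 0), ((((t μ).flatMap (fun κ => seg κ (v κ))).length : ℕ) : ℝ))
                  * ‖R (holT (unitsField (toUField W)) (embIter (K - n) y) (seg ι ((η : ℕ) : ℤ) ++ treeWord q))
                          ((holT (unitsField (toUField W)) (transl (transl (embIter (K - n) y) (((η : ℕ) : ℤ) • e ι)) q) [((t μ).getD i μ, false), (μ, true), Letter.rev ((t μ).getD i μ, false), (μ, false)] : (Matrix (Fin 2) (Fin 2) ℂ)ˣ) : Matrix (Fin 2) (Fin 2) ℂ)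
                        * ψ (embIter (K - n) y)
                      - ψ (embIter (K - n) y)
                        * R (holT (unitsField (toUField W)) (embIter (K - n) y) (seg ι ((η : ℕ) : ℤ) ++ treeWord q))
                          ((holT (unitsField (toUField W)) (transl (transl (embIter (K - n) y) (((η : ℕ) : ℤ) • e ι)) q) [((t μ).getD i μ, false), (μ, true), Letter.rev ((t μ).getD i μ, false), (μ, false)] : (Matrix (Fin 2) (Fin 2) ℂ)ˣ) : Matrix (Fin 2) (Fin 2) ℂ)‖ ^ 2))
          + 3 * ((F.P K).d : ℝ) ^ 2 * (24 / ((((F.P K).L ^ (K - n) : ℕ) : ℝ)) ^ 2)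
            * (24 / ((((F.P K).L ^ (K - n) : ℕ) : ℝ)) ^ 2 * ((((F.P K).L ^ (K - n) : ℕ) : ℝ)) ^ (F.P K).d) * ∑ y : Site (F.P K) (K - n), G y ^ 2)) := by
  have hV : ∀ b : PBond (F.P K) 0, ‖((unitsField (toUField W) b : (Matrix (Fin 2) (Fin 2) ℂ)ˣ) : Matrix (Fin 2) (Fin 2) ℂ)‖ ≤ 1
      ∧ ‖(((unitsField (toUField W) b)⁻¹ : (Matrix (Fin 2) (Fin 2) ℂ)ˣ) : Matrix (Fin 2) (Fin 2) ℂ)‖ ≤ 1 :=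
    fun b => bicontr_of_mem_unitary _ (unitsField_toUField_mem_unitary W b.dir b.src)
  have hwin' : ∀ η : Fin ℓ', (((η : ℕ) : ℤ)).natAbs * 2 < (F.P K).sitesPerDir 0 := fun η => by
    rw [Int.natAbs_natCast]; have := η.isLt; omega
  have hcard : ((Fintype.card (Fin ℓ') : ℝ))⁻¹ = (ℓ' : ℝ)⁻¹ := by rw [Fintype.card_fin]
  have main := lemmaH_curved_comb_avg_count_exact F K n hk hℓ2 W ψ hψ (H := Fin ℓ')
    (fun η y => transl (embIter (K - n) y) (((η : ℕ) : ℤ) • e ι))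
    (fun η y => R (holT (unitsField (toUField W)) (embIter (K - n) y) (seg ι ((η : ℕ) : ℤ)))⁻¹ (ψ (embIter (K - n) y)))
    (fun η y => offsetFamily_interp (unitsField (toUField W)) (embIter (K - n) y) ι _ (hwin' η) _)
    (fun η y z hz μ => ⟨(abs_rel_offset_le hk ℓ' hN y z hz η ι μ μ).2.2.1, (abs_rel_offset_le hk ℓ' hN y z hz η ι μ μ).2.2.2⟩) Z G
    (fun y z hN' μ => by rw [hcard]; exact hG y z hN' μ)
    (2 * (F.P K).L ^ (K - n) + ℓ') (fun η y z hz μ ν => ⟨(abs_rel_offset_le hk ℓ' hN y z hz η ι μ ν).1, (abs_rel_offset_le hk ℓ' hN y z hz η ι μ ν).2.1⟩)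
    s t hsplit hs ht
  rw [hcard] at main
  simp only [canonical_letter_eq_transported (unitsField (toUField W)) hV] at main
  exact main

end T3

end Summit.QuantumFields.YangMills.Theorems.Prop7OffsetFamilyTransportedExact

end
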